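import Summits.ResolutionOfSingularities.ResolutionOfSingularities.Theorems.HomologicalConductorNoZenoRMinimalResolutionOfNormalStages
import Summits.ResolutionOfSingularities.ResolutionOfSingularities.Theorems.HomologicalConductorNoZenoRLipman41Door
import HarnessLib

/-!
# Crux `NoZenoR` (stmt-ResolutionOfSingularities-19943) — the W3 print `Lipman1969_4_1` from Lipman's Proposition (8.1)
# at the stages ALONE (no contraction theorem (27.1)): a new door of record

Route `ResolutionOfSingularities/HomologicalConductor` (cell decomp-res, hand leafhand-res-homologicalconduct-21 g0).
OURS: AI-written bookkeeping over tree theorems, weaker than expert review; nothing here is a statement of the manuscript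
under review (Hironaka 2017).  SUPPORT level, counted 0.  Def-free; no named fact assumed — the theorems are
CONDITIONAL on the explicit hypothesis `H81` (Lipman Prop. (8.1) at the stages, see
`…NoZenoRMinimalResolutionOfNormalStages`).

Hands 16 g3 / 16 g4 / 18 g1 reduced the print `Lipman1969_4_1` of the registered stub `stub_publishedSurfaceFactsW3` to
`Lipman1969_27_1_reg_rat` (Castelnuovo's contraction, XL) + «LMRB».  This hand's assembly of Lipman's OWN proof gives a
SECOND door which does not pass through (27.1):

* **`Lipman1969_4_1_of_normalStages`** — `Lipman1969_4_1.{0}` (the minimal desingularization of a normal surface with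
  finitely many rational singular points) follows from `H81`: for every two-dimensional normal Noetherian local domain
  `S` with a rational singularity, every blowing up of a NORMAL stage of `Spec S` (integral Noetherian, proper birational
  over `Spec S`) at a non-regular closed point has integrally closed local rings — Lipman's Proposition (8.1) ("a
  quadratic transformation of a normal surface having only rational singularities is a normal surface") read at the local
  rings of the stages, which have rational singularities by Prop. (1.2) 1) (tree theorem `Lipman1969_1_2_holds`);
  via `exists_isMinimalResolution_isBlowup_of_normalStages` and hand 16 g4's print-free door
  `GlobalResolution.Lipman1969_4_1_of_localMinimalBlowup`;
* `exists_isMinimalResolution_Spec_of_normalStages` — the consumed LOCAL form (the shape of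
  `Lipman1969_4_1.exists_isMinimalResolution_Spec` used by the crux chain) from the local `h81`.

So the print debt `Lipman1969_4_1` is now `⟸ min(Lipman1969_27_1_reg_rat + LMRB, (8.1)-at-stages)`; (8.1) is Lipman
§8 over §§5–7 (complete ideals; products of complete ideals are complete in a rational singularity, Thm. (7.1)) — XL, not
proved here.  No crux, kill test or summit statement is proved here; resolution in positive characteristic is NOT proved.

References: J. Lipman, Publ. Math. IHÉS 36 (1969), Theorem (4.1) (p. 204), Proposition (8.1) (p. 212), Theorem (7.1)
(p. 209) [`Lipman1969`].
-/

noncomputable section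

-- single-problem summit: the doubled namespace component `ResolutionOfSingularities` is forced
set_option linter.dupNamespace false

open CategoryTheory CategoryTheory.Limits AlgebraicGeometry TopologicalSpace IsLocalRing
open Literature.AlgebraicGeometry.Resolution

namespace Summit.ResolutionOfSingularities.ResolutionOfSingularities.Theorems.NoZeno.QuadraticTransform

/-- **`Lipman1969_4_1` from Prop. (8.1) at the stages, without (27.1).**  See the module docstring.
[cite: Lipman1969, Theorem (4.1) and its proof (pp. 204–205); Proposition (8.1) (p. 212)] -/
theorem Lipman1969_4_1_of_normalStages
    (H81 : ∀ (S : Type) [CommRing S] [IsNoetherianRing S] [IsLocalRing S] [IsDomain S] [IsIntegrallyClosed S],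
      ringKrullDim S = 2 → HasRationalSingularity S →
      ∀ (W W₂ : Scheme.{0}) (_ : IsIntegral W) (_ : IsNoetherian W) (g : W ⟶ Spec (.of S)) (_ : IsProper g),
        IsBirational g → (∀ y : W, IsIntegrallyClosed (W.presheaf.stalk y)) →
        ∀ (w : W) (hwc : IsClosed ({w} : Set W)), ¬ IsRegularLocalRing (W.presheaf.stalk w) →
        ∀ (b : W₂ ⟶ W), IsBlowup b (Scheme.IdealSheafData.vanishingIdeal ⟨{w}, hwc⟩) →
        ∀ y : W₂, IsIntegrallyClosed (W₂.presheaf.stalk y)) :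
    Lipman1969_4_1.{0} :=
  GlobalResolution.Lipman1969_4_1_of_localMinimalBlowup fun S _ _ _ _ _ h2 hS =>
    exists_isMinimalResolution_isBlowup_of_normalStages h2 hS (H81 S h2 hS)

/-- **The consumed local form**: under the local (8.1)-hypothesis `h81` for `S`, a two-dimensional normal Noetherian local
domain `S` with a rational singularity has a minimal desingularization of `Spec S` (the shape
`Lipman1969_4_1.exists_isMinimalResolution_Spec` used throughout the crux chain).
[cite: Lipman1969, Theorem (4.1) (p. 204)] -/
theorem exists_isMinimalResolution_Spec_of_normalStages {S : Type} [CommRing S] [IsNoetherianRing S] [IsLocalRing S]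
    [IsDomain S] [IsIntegrallyClosed S] (hdim : ringKrullDim S = 2) (hrat : HasRationalSingularity S)
    (h81 : ∀ (W W₂ : Scheme.{0}) (_ : IsIntegral W) (_ : IsNoetherian W) (g : W ⟶ Spec (.of S)) (_ : IsProper g),
      IsBirational g → (∀ y : W, IsIntegrallyClosed (W.presheaf.stalk y)) →
      ∀ (w : W) (hwc : IsClosed ({w} : Set W)), ¬ IsRegularLocalRing (W.presheaf.stalk w) →
      ∀ (b : W₂ ⟶ W), IsBlowup b (Scheme.IdealSheafData.vanishingIdeal ⟨{w}, hwc⟩) →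
      ∀ y : W₂, IsIntegrallyClosed (W₂.presheaf.stalk y)) :
    ∃ (X₀ : Scheme.{0}) (f : X₀ ⟶ Spec (.of S)), IsMinimalResolution f := by
  obtain ⟨X₀, f, -, hf, -, -⟩ := exists_isMinimalResolution_isBlowup_of_normalStages hdim hrat h81
  exact ⟨X₀, f, hf⟩

end Summit.ResolutionOfSingularities.ResolutionOfSingularities.Theorems.NoZeno.QuadraticTransform

end
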